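import Summits.KontsevichZagierPeriods.KontsevichZagierPeriods.Theorems.HurwitzMicroSectorsNormalFormPrincipleWeightNAlgReduction
import Summits.KontsevichZagierPeriods.KontsevichZagierPeriods.Theorems.HurwitzMicroSectorsNormalFormPrincipleStokesLayer
import Summits.KontsevichZagierPeriods.KontsevichZagierPeriods.Theorems.HurwitzMicroSectorsNormalFormPrincipleLevelTwoOdd

/-!
# `NormalFormPrinciple` (stmt-KontsevichZagierPeriods-3869), line `SketchIdeator1` — leaf `stub_boxRigidity`:
# ALL WEIGHTS, ALL LEVELS, TOTALLY OFF RESONANCE, REAL-ALGEBRAIC COEFFICIENTS, II: Conjecture 1 (kernel form)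

The subgroup of `FormalRep` generated by the boxes `[(0,1)^w, c (Π xₗ^{eₗ})/(1 − Π xₗ^{kₗ})]`
(`w ≥ 2`, `kₗ ≥ 1`, resonance parameters `θₗ = (eₗ+1)/kₗ` pairwise distinct, `c ∈ ℚ̄ ∩ ℝ`), the
representations of KZ's rational shape of dimension `≤ 1`, the `K`-rational slabs `[(a,b), P/Q]` with
algebraic ends and the algebraic points is congruent modulo relations to the subgroup generated by
the last three (part I), on which seat c4's kernel theorem
`Dlog.mem_relations_of_eval_eq_zero_of_algSlab` (Baker) applies: CONJECTURE 1 OF KONTSEVICH–ZAGIER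
HOLDS, IN KERNEL FORM, ON THIS LAYER UNCONDITIONALLY
(`offresNAlg_mem_relations_of_eval_eq_zero_of_mem_closure`); e.g.
`√2·∫_{(0,1)⁴} x₁x₂²x₃³/(1 − x₀x₁x₂x₃) = √2/18` against `[pt, √2/18]`. Values covered: the
`ℚ̄`-span of `1, π` and the logarithms of algebraic numbers reached by digamma differences at
rational arguments. Finally the BAKER WORLD capstone: one kernel theorem for the subgroup generated by
the Stokes-exact squares (`…StokesLayer`), the odd level-two boxes (`…LevelTwoOdd`), these boxes and
the algebraic-slab generators together
(`bakerWorld_mem_relations_of_eval_eq_zero_of_mem_closure`).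
[cite: KontsevichZagier2001, §1.2 Conjecture 1] No new definitions.
-/

noncomputable section

open MeasureTheory Set
open scoped Polynomial
open Literature.NumberTheory.Transcendental Literature.NumberTheory.Transcendental.KZ
open Literature.ModelTheory.ExponentialFields (IsSemialgebraic)

namespace Summit.KontsevichZagierPeriods.HurwitzMicroSectors.NormalFormPrinciple.PiBox.WeightN

open Summit.KontsevichZagierPeriods.HurwitzMicroSectors.NormalFormPrinciple.PiBox.Dlog
  (mem_relations_of_eval_eq_zero_of_algSlab)

/-- Every element of the subgroup generated by the totally-off-resonance boxes WITH REAL-ALGEBRAIC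
COEFFICIENTS (all weights `≥ 2`, all levels) together with seat c4's algebraic-slab generators is
congruent modulo relations to an element of the latter subgroup. [cite: KontsevichZagier2001, §1.2] -/
theorem exists_mem_algSlabClosure_of_mem_offresNAlgClosure {x : FormalRep}
    (hx : x ∈ AddSubgroup.closure
      ({y : FormalRep | ∃ (n : ℕ) (k e : Fin (n + 2) → ℕ) (c : ℝ) (N : IntegralRep (n + 2)),
          (∀ i, 0 < k i) ∧ (∀ i j, i ≠ j → (e i + 1) * k j ≠ (e j + 1) * k i) ∧ IsAlgebraic ℚ c ∧
          N.domain = {x | ∀ i, x i ∈ Set.Ioo (0:ℝ) 1} ∧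
          EqOn N.integrand (fun x => c * (∏ l, x l ^ (e l)) / (1 - ∏ l, x l ^ (k l))) N.domain ∧
          y = of N} ∪
       ({y : FormalRep | ∃ (m : ℕ) (N : IntegralRep m), m ≤ 1 ∧ N.IsRational ∧ y = of N} ∪
        {y : FormalRep | ∃ (a b : ℝ) (P Q : (algebraicClosure ℚ ℝ)[X]) (N : IntegralRep 1),
          IsAlgebraic ℚ a ∧ IsAlgebraic ℚ b ∧ (∀ t ∈ Set.Icc a b, (Polynomial.aeval t Q : ℝ) ≠ 0) ∧
          N.domain = {x | x 0 ∈ Set.Ioo a b} ∧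
          EqOn N.integrand (fun x => (Polynomial.aeval (x 0) P : ℝ) / Polynomial.aeval (x 0) Q) N.domain ∧
          y = of N} ∪
        {y : FormalRep | ∃ (r : ℝ) (Z : IntegralRep 0), IsAlgebraic ℚ r ∧ Z.domain = univ ∧
          (Z.integrand = fun _ => r) ∧ y = of Z}))) :
    ∃ x' ∈ AddSubgroup.closure
      ({y : FormalRep | ∃ (m : ℕ) (N : IntegralRep m), m ≤ 1 ∧ N.IsRational ∧ y = of N} ∪
       {y : FormalRep | ∃ (a b : ℝ) (P Q : (algebraicClosure ℚ ℝ)[X]) (N : IntegralRep 1),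
          IsAlgebraic ℚ a ∧ IsAlgebraic ℚ b ∧ (∀ t ∈ Set.Icc a b, (Polynomial.aeval t Q : ℝ) ≠ 0) ∧
          N.domain = {x | x 0 ∈ Set.Ioo a b} ∧
          EqOn N.integrand (fun x => (Polynomial.aeval (x 0) P : ℝ) / Polynomial.aeval (x 0) Q) N.domain ∧
          y = of N} ∪
       {y : FormalRep | ∃ (r : ℝ) (Z : IntegralRep 0), IsAlgebraic ℚ r ∧ Z.domain = univ ∧
          (Z.integrand = fun _ => r) ∧ y = of Z}),
      x - x' ∈ relations := by
  induction hx using AddSubgroup.closure_induction with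
  | mem y hy =>
    rcases hy with hy | hy
    · obtain ⟨n, k, e, c, N, hk, hres, hc, hNd, hNi, rfl⟩ := hy
      exact offresNAlg_exists_mem_algSlabClosure n k e hk hres c hc N hNd hNi
    · exact ⟨y, AddSubgroup.subset_closure hy, by simp [relations.zero_mem]⟩
  | zero => exact ⟨0, AddSubgroup.zero_mem _, by simp [relations.zero_mem]⟩
  | add y z _ _ ihy ihz =>
    obtain ⟨y', hy', ey⟩ := ihy
    obtain ⟨z', hz', ez⟩ := ihz
    refine ⟨y' + z', AddSubgroup.add_mem _ hy' hz', ?_⟩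
    have e : y + z - (y' + z') = (y - y') + (z - z') := by abel
    rw [e]
    exact relations.add_mem ey ez
  | neg y _ ihy =>
    obtain ⟨y', hy', ey⟩ := ihy
    refine ⟨-y', AddSubgroup.neg_mem _ hy', ?_⟩
    have e : -y - -y' = -(y - y') := by abel
    rw [e]
    exact relations.neg_mem ey

/-- **Conjecture 1 of Kontsevich–Zagier, kernel form, for the TOTALLY-OFF-RESONANCE BOX LAYER OF ALL
WEIGHTS AND LEVELS WITH REAL-ALGEBRAIC COEFFICIENTS, jointly with every representation of dimension
`≤ 1` of KZ's rational shape, every `K`-rational slab `[(a,b), P/Q]` with algebraic ends and every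
algebraic point** — unconditionally (the box chains of `…WeightNLayer` with `c ∈ ℚ̄ ∩ ℝ` end in
`K`-rational slabs on `(0,1)`; then seat c4's `Dlog.mem_relations_of_eval_eq_zero_of_algSlab`, Baker).
[cite: KontsevichZagier2001, §1.2 Conjecture 1] -/
theorem offresNAlg_mem_relations_of_eval_eq_zero_of_mem_closure {x : FormalRep}
    (hx : x ∈ AddSubgroup.closure
      ({y : FormalRep | ∃ (n : ℕ) (k e : Fin (n + 2) → ℕ) (c : ℝ) (N : IntegralRep (n + 2)),
          (∀ i, 0 < k i) ∧ (∀ i j, i ≠ j → (e i + 1) * k j ≠ (e j + 1) * k i) ∧ IsAlgebraic ℚ c ∧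
          N.domain = {x | ∀ i, x i ∈ Set.Ioo (0:ℝ) 1} ∧
          EqOn N.integrand (fun x => c * (∏ l, x l ^ (e l)) / (1 - ∏ l, x l ^ (k l))) N.domain ∧
          y = of N} ∪
       ({y : FormalRep | ∃ (m : ℕ) (N : IntegralRep m), m ≤ 1 ∧ N.IsRational ∧ y = of N} ∪
        {y : FormalRep | ∃ (a b : ℝ) (P Q : (algebraicClosure ℚ ℝ)[X]) (N : IntegralRep 1),
          IsAlgebraic ℚ a ∧ IsAlgebraic ℚ b ∧ (∀ t ∈ Set.Icc a b, (Polynomial.aeval t Q : ℝ) ≠ 0) ∧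
          N.domain = {x | x 0 ∈ Set.Ioo a b} ∧
          EqOn N.integrand (fun x => (Polynomial.aeval (x 0) P : ℝ) / Polynomial.aeval (x 0) Q) N.domain ∧
          y = of N} ∪
        {y : FormalRep | ∃ (r : ℝ) (Z : IntegralRep 0), IsAlgebraic ℚ r ∧ Z.domain = univ ∧
          (Z.integrand = fun _ => r) ∧ y = of Z})))
    (hv : eval x = 0) : x ∈ relations := by
  obtain ⟨x', hx', e⟩ := exists_mem_algSlabClosure_of_mem_offresNAlgClosure hx
  have h0 : eval x' = 0 := by
    have h := relations_le_ker_eval_holds e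
    rw [AddMonoidHom.mem_ker, map_sub, hv, zero_sub, neg_eq_zero] at h
    exact h
  have hx'r := mem_relations_of_eval_eq_zero_of_algSlab hx' h0
  have e' : x = (x - x') + x' := by abel
  rw [e']
  exact relations.add_mem e hx'r

/-- **An algebraic multiple of a totally-off-resonance box against an algebraic point** — e.g.
`√2·∫_{(0,1)⁴} x₁x₂²x₃³/(1 − x₀x₁x₂x₃) = √2/18` against `[pt, √2/18]`: equal values imply
KZ-equivalence, unconditionally. [cite: KontsevichZagier2001, §1.2 Conjecture 1] -/
theorem offresNAlg_equivalent_pt_of_value_eq (n : ℕ) (k e : Fin (n + 2) → ℕ) (hk : ∀ i, 0 < k i)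
    (hres : ∀ i j, i ≠ j → (e i + 1) * k j ≠ (e j + 1) * k i) (c r : ℝ) (hc : IsAlgebraic ℚ c)
    (hr : IsAlgebraic ℚ r) (N : IntegralRep (n + 2)) (Z : IntegralRep 0)
    (hNd : N.domain = {x | ∀ i, x i ∈ Set.Ioo (0:ℝ) 1})
    (hNi : EqOn N.integrand (fun x => c * (∏ l, x l ^ (e l)) / (1 - ∏ l, x l ^ (k l))) N.domain)
    (hZd : Z.domain = univ) (hZi : Z.integrand = fun _ => r)
    (hv : N.value = Z.value) : Equivalent N Z := by
  refine offresNAlg_mem_relations_of_eval_eq_zero_of_mem_closure (AddSubgroup.sub_mem _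
    (AddSubgroup.subset_closure (Or.inl ⟨n, k, e, c, N, hk, hres, hc, hNd, hNi, rfl⟩))
    (AddSubgroup.subset_closure (Or.inr (Or.inr ⟨r, Z, hr, hZd, hZi, rfl⟩)))) ?_
  rw [map_sub, eval_of, eval_of, hv, sub_self]

/-- **Two algebraic multiples of totally-off-resonance boxes (any weights `≥ 2`, any levels) with equal
values are KZ-equivalent** (unconditionally). [cite: KontsevichZagier2001, §1.2 Conjecture 1] -/
theorem offresNAlg_equivalent_of_value_eq (n n' : ℕ) (k e : Fin (n + 2) → ℕ) (k' e' : Fin (n' + 2) → ℕ)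
    (hk : ∀ i, 0 < k i) (hres : ∀ i j, i ≠ j → (e i + 1) * k j ≠ (e j + 1) * k i)
    (hk' : ∀ i, 0 < k' i) (hres' : ∀ i j, i ≠ j → (e' i + 1) * k' j ≠ (e' j + 1) * k' i) (c c' : ℝ)
    (hc : IsAlgebraic ℚ c) (hc' : IsAlgebraic ℚ c') (N : IntegralRep (n + 2)) (N' : IntegralRep (n' + 2))
    (hNd : N.domain = {x | ∀ i, x i ∈ Set.Ioo (0:ℝ) 1})
    (hNi : EqOn N.integrand (fun x => c * (∏ l, x l ^ (e l)) / (1 - ∏ l, x l ^ (k l))) N.domain)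
    (hN'd : N'.domain = {x | ∀ i, x i ∈ Set.Ioo (0:ℝ) 1})
    (hN'i : EqOn N'.integrand (fun x => c' * (∏ l, x l ^ (e' l)) / (1 - ∏ l, x l ^ (k' l))) N'.domain)
    (hv : N.value = N'.value) : Equivalent N N' := by
  refine offresNAlg_mem_relations_of_eval_eq_zero_of_mem_closure (AddSubgroup.sub_mem _
    (AddSubgroup.subset_closure (Or.inl ⟨n, k, e, c, N, hk, hres, hc, hNd, hNi, rfl⟩))
    (AddSubgroup.subset_closure (Or.inl ⟨n', k', e', c', N', hk', hres', hc', hN'd, hN'i, rfl⟩))) ?_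
  rw [map_sub, eval_of, eval_of, hv, sub_self]

/-! ## The Baker world of this line: one kernel theorem -/

open Summit.KontsevichZagierPeriods.HurwitzMicroSectors.NormalFormPrinciple.PiBox.Stokes
  (exists_mem_dimLeOneClosure_sub_of_stokesExact)
open Summit.KontsevichZagierPeriods.HurwitzMicroSectors.NormalFormPrinciple.PiBox.AlgLevelTwo (levelTwo_nf_odd)


/-- **A dlog carrier `Λ(2, γ) = [(1,2), γ/y]` with algebraic `γ` is an algebraic-slab generator**
(`P = C γ`, `Q = X`, pole-free on `[1,2]`). [cite: KontsevichZagier2001, §1.1] -/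
theorem dlogTwo_mem_algSlab {γ : ℝ} (hγ : IsAlgebraic ℚ γ) (L : IntegralRep 1)
    (hLd : L.domain = {x : Fin 1 → ℝ | x 0 ∈ Set.Ioo (1:ℝ) 2}) (hLi : L.integrand = fun x => γ / x 0) :
    of L ∈ {y : FormalRep | ∃ (a b : ℝ) (P Q : (algebraicClosure ℚ ℝ)[X]) (N : IntegralRep 1),
          IsAlgebraic ℚ a ∧ IsAlgebraic ℚ b ∧ (∀ t ∈ Set.Icc a b, (Polynomial.aeval t Q : ℝ) ≠ 0) ∧
          N.domain = {x | x 0 ∈ Set.Ioo a b} ∧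
          EqOn N.integrand (fun x => (Polynomial.aeval (x 0) P : ℝ) / Polynomial.aeval (x 0) Q) N.domain ∧
          y = of N} := by
  have hγK : γ ∈ algebraicClosure ℚ ℝ := mem_algebraicClosure_iff.mpr hγ
  refine ⟨1, 2, Polynomial.C ⟨γ, hγK⟩, Polynomial.X, L, isAlgebraic_one, ?_, fun t ht => ?_, hLd,
    fun x _ => ?_, rfl⟩
  · simpa using isAlgebraic_algebraMap (R := ℚ) (A := ℝ) (2:ℚ)
  · rw [Polynomial.aeval_X]; exact (lt_of_lt_of_le one_pos ht.1).ne'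
  · rw [hLi]
    simp only [Polynomial.aeval_C, Polynomial.aeval_X, IntermediateField.algebraMap_apply]

/-- **An odd level-two box is congruent to an element of the algebraic-slab subgroup** (its dlog
normal form `Λ(2, γ) + [pt, q]` of `…LevelTwoOdd`). [cite: KontsevichZagier2001, §1.2] -/
theorem oddLevelTwo_exists_mem_algSlabClosure (P : MvPolynomial (Fin 2) ℝ)
    (hP : ∀ s, IsAlgebraic ℚ (P.coeff s)) (hodd : ∀ s ∈ P.support, Odd (s 0 + s 1)) (N : IntegralRep 2)
    (hNd : N.domain = {x | ∀ i, x i ∈ Set.Ioo (0:ℝ) 1})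
    (hNi : EqOn N.integrand (fun x => MvPolynomial.eval x P / (1 - x 0 ^ 2 * x 1 ^ 2)) N.domain) :
    ∃ x' ∈ AddSubgroup.closure
      ({y : FormalRep | ∃ (m : ℕ) (N : IntegralRep m), m ≤ 1 ∧ N.IsRational ∧ y = of N} ∪
       {y : FormalRep | ∃ (a b : ℝ) (P Q : (algebraicClosure ℚ ℝ)[X]) (N : IntegralRep 1),
          IsAlgebraic ℚ a ∧ IsAlgebraic ℚ b ∧ (∀ t ∈ Set.Icc a b, (Polynomial.aeval t Q : ℝ) ≠ 0) ∧
          N.domain = {x | x 0 ∈ Set.Ioo a b} ∧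
          EqOn N.integrand (fun x => (Polynomial.aeval (x 0) P : ℝ) / Polynomial.aeval (x 0) Q) N.domain ∧
          y = of N} ∪
       {y : FormalRep | ∃ (r : ℝ) (Z : IntegralRep 0), IsAlgebraic ℚ r ∧ Z.domain = univ ∧
          (Z.integrand = fun _ => r) ∧ y = of Z}),
      of N - x' ∈ relations := by
  obtain ⟨r, C, Z, L, hr, hC, hZd, hZi, hL, e⟩ := levelTwo_nf_odd P hP hodd N hNd hNi
  refine ⟨of Z + ∑ i, of (L i), AddSubgroup.add_mem _
    (AddSubgroup.subset_closure (Or.inr ⟨r, Z, hr, hZd, hZi, rfl⟩))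
    (AddSubgroup.sum_mem _ fun i _ => AddSubgroup.subset_closure (Or.inl (Or.inr
      (dlogTwo_mem_algSlab (hC i) (L i) (hL i).1 (hL i).2)))), ?_⟩
  have ee : of N - (of Z + ∑ i, of (L i)) = of N - of Z - ∑ i, of (L i) := by abel
  rw [ee]
  exact e

/-- Every element of the subgroup generated by the Stokes-exact squares, the `ℚ̄`-multiples of the
totally-off-resonance boxes of all weights and levels, and seat c4's algebraic-slab generators is
congruent modulo relations to an element of the latter subgroup. [cite: KontsevichZagier2001, §1.2] -/
theorem exists_mem_algSlabClosure_of_mem_bakerWorldClosure {x : FormalRep}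
    (hx : x ∈ AddSubgroup.closure
      ({y : FormalRep | ∃ (i : Fin 2) (T : RFun 2), y = of (T.pd i).rep} ∪
       {y : FormalRep | ∃ (P : MvPolynomial (Fin 2) ℝ) (N : IntegralRep 2),
          (∀ s, IsAlgebraic ℚ (P.coeff s)) ∧ (∀ s ∈ P.support, Odd (s 0 + s 1)) ∧
          N.domain = {x | ∀ i, x i ∈ Set.Ioo (0:ℝ) 1} ∧
          EqOn N.integrand (fun x => MvPolynomial.eval x P / (1 - x 0 ^ 2 * x 1 ^ 2)) N.domain ∧
          y = of N} ∪
       {y : FormalRep | ∃ (n : ℕ) (k e : Fin (n + 2) → ℕ) (c : ℝ) (N : IntegralRep (n + 2)),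
          (∀ i, 0 < k i) ∧ (∀ i j, i ≠ j → (e i + 1) * k j ≠ (e j + 1) * k i) ∧ IsAlgebraic ℚ c ∧
          N.domain = {x | ∀ i, x i ∈ Set.Ioo (0:ℝ) 1} ∧
          EqOn N.integrand (fun x => c * (∏ l, x l ^ (e l)) / (1 - ∏ l, x l ^ (k l))) N.domain ∧
          y = of N} ∪
       ({y : FormalRep | ∃ (m : ℕ) (N : IntegralRep m), m ≤ 1 ∧ N.IsRational ∧ y = of N} ∪
       {y : FormalRep | ∃ (a b : ℝ) (P Q : (algebraicClosure ℚ ℝ)[X]) (N : IntegralRep 1),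
          IsAlgebraic ℚ a ∧ IsAlgebraic ℚ b ∧ (∀ t ∈ Set.Icc a b, (Polynomial.aeval t Q : ℝ) ≠ 0) ∧
          N.domain = {x | x 0 ∈ Set.Ioo a b} ∧
          EqOn N.integrand (fun x => (Polynomial.aeval (x 0) P : ℝ) / Polynomial.aeval (x 0) Q) N.domain ∧
          y = of N} ∪
       {y : FormalRep | ∃ (r : ℝ) (Z : IntegralRep 0), IsAlgebraic ℚ r ∧ Z.domain = univ ∧
          (Z.integrand = fun _ => r) ∧ y = of Z}))) :
    ∃ x' ∈ AddSubgroup.closure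
      ({y : FormalRep | ∃ (m : ℕ) (N : IntegralRep m), m ≤ 1 ∧ N.IsRational ∧ y = of N} ∪
       {y : FormalRep | ∃ (a b : ℝ) (P Q : (algebraicClosure ℚ ℝ)[X]) (N : IntegralRep 1),
          IsAlgebraic ℚ a ∧ IsAlgebraic ℚ b ∧ (∀ t ∈ Set.Icc a b, (Polynomial.aeval t Q : ℝ) ≠ 0) ∧
          N.domain = {x | x 0 ∈ Set.Ioo a b} ∧
          EqOn N.integrand (fun x => (Polynomial.aeval (x 0) P : ℝ) / Polynomial.aeval (x 0) Q) N.domain ∧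
          y = of N} ∪
       {y : FormalRep | ∃ (r : ℝ) (Z : IntegralRep 0), IsAlgebraic ℚ r ∧ Z.domain = univ ∧
          (Z.integrand = fun _ => r) ∧ y = of Z}),
      x - x' ∈ relations := by
  induction hx using AddSubgroup.closure_induction with
  | mem y hy =>
    rcases hy with ((hy | hy) | hy) | hy
    · obtain ⟨i, T, rfl⟩ := hy
      obtain ⟨x', hx', e⟩ := exists_mem_dimLeOneClosure_sub_of_stokesExact i T
      exact ⟨x', AddSubgroup.closure_mono (fun z hz => Or.inl (Or.inl hz)) hx', e⟩
    · obtain ⟨P, N, hP, hodd, hNd, hNi, rfl⟩ := hy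
      exact oddLevelTwo_exists_mem_algSlabClosure P hP hodd N hNd hNi
    · obtain ⟨n, k, e, c, N, hk, hres, hc, hNd, hNi, rfl⟩ := hy
      exact offresNAlg_exists_mem_algSlabClosure n k e hk hres c hc N hNd hNi
    · exact ⟨y, AddSubgroup.subset_closure hy, by simp [relations.zero_mem]⟩
  | zero => exact ⟨0, AddSubgroup.zero_mem _, by simp [relations.zero_mem]⟩
  | add y z _ _ ihy ihz =>
    obtain ⟨y', hy', ey⟩ := ihy
    obtain ⟨z', hz', ez⟩ := ihz
    refine ⟨y' + z', AddSubgroup.add_mem _ hy' hz', ?_⟩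
    have e : y + z - (y' + z') = (y - y') + (z - z') := by abel
    rw [e]
    exact relations.add_mem ey ez
  | neg y _ ihy =>
    obtain ⟨y', hy', ey⟩ := ihy
    refine ⟨-y', AddSubgroup.neg_mem _ hy', ?_⟩
    have e : -y - -y' = -(y - y') := by abel
    rw [e]
    exact relations.neg_mem ey

/-- **Conjecture 1 of Kontsevich–Zagier, kernel form, for THE WHOLE BAKER WORLD OF THIS LINE** —
unconditionally: formal `ℤ`-combinations of Stokes-exact squares `[[0,1]², ∂ᵢ(P/Q)]`, of odd
level-two boxes `[(0,1)², P/(1 − x²y²)]` (`P ∈ (ℚ̄∩ℝ)[x,y]` odd; values in `ℚ̄ + ℚ̄ log 2`), of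
`ℚ̄`-multiples of totally-off-resonance boxes `[(0,1)^w, c Πxₗ^{eₗ}/(1 − Πxₗ^{kₗ})]` (all weights
`w ≥ 2`, all levels, `θₗ` pairwise distinct), of all representations of KZ's rational shape of
dimension `≤ 1`, of all `K`-rational slabs `[(a,b), P/Q]` with algebraic ends and of all algebraic
points, of value `0`, are relations (every generator is moved by rules (2), (3), (1) into seat c4's
algebraic-slab layer, where Baker's theorem decides: values in `ℚ̄ + ℚ̄π + Σ ℚ̄ log ℚ̄`). The
complementary `ℚ̄[π²]` world is `…PiWorld`; joining the two needs the algebraic independence of `π`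
from logarithms of algebraic numbers (open). [cite: KontsevichZagier2001, §1.2 Conjecture 1] -/
theorem bakerWorld_mem_relations_of_eval_eq_zero_of_mem_closure {x : FormalRep}
    (hx : x ∈ AddSubgroup.closure
      ({y : FormalRep | ∃ (i : Fin 2) (T : RFun 2), y = of (T.pd i).rep} ∪
       {y : FormalRep | ∃ (P : MvPolynomial (Fin 2) ℝ) (N : IntegralRep 2),
          (∀ s, IsAlgebraic ℚ (P.coeff s)) ∧ (∀ s ∈ P.support, Odd (s 0 + s 1)) ∧
          N.domain = {x | ∀ i, x i ∈ Set.Ioo (0:ℝ) 1} ∧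
          EqOn N.integrand (fun x => MvPolynomial.eval x P / (1 - x 0 ^ 2 * x 1 ^ 2)) N.domain ∧
          y = of N} ∪
       {y : FormalRep | ∃ (n : ℕ) (k e : Fin (n + 2) → ℕ) (c : ℝ) (N : IntegralRep (n + 2)),
          (∀ i, 0 < k i) ∧ (∀ i j, i ≠ j → (e i + 1) * k j ≠ (e j + 1) * k i) ∧ IsAlgebraic ℚ c ∧
          N.domain = {x | ∀ i, x i ∈ Set.Ioo (0:ℝ) 1} ∧
          EqOn N.integrand (fun x => c * (∏ l, x l ^ (e l)) / (1 - ∏ l, x l ^ (k l))) N.domain ∧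
          y = of N} ∪
       ({y : FormalRep | ∃ (m : ℕ) (N : IntegralRep m), m ≤ 1 ∧ N.IsRational ∧ y = of N} ∪
       {y : FormalRep | ∃ (a b : ℝ) (P Q : (algebraicClosure ℚ ℝ)[X]) (N : IntegralRep 1),
          IsAlgebraic ℚ a ∧ IsAlgebraic ℚ b ∧ (∀ t ∈ Set.Icc a b, (Polynomial.aeval t Q : ℝ) ≠ 0) ∧
          N.domain = {x | x 0 ∈ Set.Ioo a b} ∧
          EqOn N.integrand (fun x => (Polynomial.aeval (x 0) P : ℝ) / Polynomial.aeval (x 0) Q) N.domain ∧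
          y = of N} ∪
       {y : FormalRep | ∃ (r : ℝ) (Z : IntegralRep 0), IsAlgebraic ℚ r ∧ Z.domain = univ ∧
          (Z.integrand = fun _ => r) ∧ y = of Z})))
    (hv : eval x = 0) : x ∈ relations := by
  obtain ⟨x', hx', e⟩ := exists_mem_algSlabClosure_of_mem_bakerWorldClosure hx
  have h0 : eval x' = 0 := by
    have h := relations_le_ker_eval_holds e
    rw [AddMonoidHom.mem_ker, map_sub, hv, zero_sub, neg_eq_zero] at h
    exact h
  have hx'r := mem_relations_of_eval_eq_zero_of_algSlab hx' h0
  have e' : x = (x - x') + x' := by abel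
  rw [e']
  exact relations.add_mem e hx'r

/-- **A Stokes-exact square against a `ℚ̄`-multiple of a totally-off-resonance box** (two very
different geometric origins of Baker-type periods): equal values imply KZ-equivalence, unconditionally.
[cite: KontsevichZagier2001, §1.2 Conjecture 1] -/
theorem stokesExact_equivalent_offresNAlg_of_value_eq (i : Fin 2) (T : RFun 2) (n : ℕ)
    (k e : Fin (n + 2) → ℕ) (hk : ∀ i, 0 < k i) (hres : ∀ i j, i ≠ j → (e i + 1) * k j ≠ (e j + 1) * k i)
    (c : ℝ) (hc : IsAlgebraic ℚ c) (N : IntegralRep (n + 2))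
    (hNd : N.domain = {x | ∀ i, x i ∈ Set.Ioo (0:ℝ) 1})
    (hNi : EqOn N.integrand (fun x => c * (∏ l, x l ^ (e l)) / (1 - ∏ l, x l ^ (k l))) N.domain)
    (hv : (T.pd i).rep.value = N.value) : Equivalent (T.pd i).rep N := by
  refine bakerWorld_mem_relations_of_eval_eq_zero_of_mem_closure (AddSubgroup.sub_mem _
    (AddSubgroup.subset_closure (Or.inl (Or.inl (Or.inl ⟨i, T, rfl⟩))))
    (AddSubgroup.subset_closure (Or.inl (Or.inr ⟨n, k, e, c, N, hk, hres, hc, hNd, hNi, rfl⟩)))) ?_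
  rw [map_sub, eval_of, eval_of, hv, sub_self]

end Summit.KontsevichZagierPeriods.HurwitzMicroSectors.NormalFormPrinciple.PiBox.WeightN
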